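import Mathlib
import Summits.KontsevichZagierPeriods.KontsevichZagierPeriods.Theorems.SoloInformedKZSaturation
import HarnessLib
import HarnessLib.Audit

/-!
# SoloInformed — a complex Ayoub generator `θ` with `Ev θ = 2πi`

Ayoub's period ring is `𝒫 := 𝒫^eff[θ⁻¹]` for an element `θ ∈ 𝒫^eff` with `Ev θ = 2πi`
[Ayoub 2014, Def. 10]. In the typed setting of `Theorems/SoloInformedAyoubSymbols.lean`
(generators = functions holomorphic on a polydisc of radius `> 1`, real on real points, algebraic
over `ℚ(z)`; complex symbols = pairs of real symbols, `Theorems/SoloInformedAyoubComplex.lean`)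
such a `θ` exists: `θ = g + i h` with `g = 0` and `h = 2π̂ = 8 / ((t − 1)² + 1)`, a generator on
the disc of radius `√2` (poles at `1 ± i`) with `∫₀¹ h = 8 · (arctan 0 − arctan (−1)) = 2π`.

* `soloInformedThetaIm` — the generator `8 / ((t − 1)² + 1)`; `soloInformedThetaRe` — the zero
  generator; `soloInformed_integral_theta` — `∫₀¹ 8 dt / ((t − 1)² + 1) = 2π` (fundamental
  theorem of calculus with the primitive `8 · arctan (t − 1)`);
  `soloInformedAyoubEv_thetaIm` — `Ev [2π̂] = 2π` (transport `ℝ¹ ≃ ℝ`);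
* `soloInformed_ayoubTheta_exists` — **the `θ`-clause of `SoloInformedAyoubEvInjLoc` is
  satisfiable**: `∃ g h, Ev[g] + Ev[h]·i = 2πi`.

References: J. Ayoub, *Periods and the conjectures of Grothendieck and Kontsevich–Zagier*, EMS
Newsl. 91 (2014) 12–18, Def. 10; M. Kontsevich, D. Zagier, *Periods* (2001), §1.1 (`π = ∫∫_{x²+y²≤1}`,
`π = ∫ dx/(1+x²)`).
-/

noncomputable section

open scoped BigOperators
open Set MeasureTheory
open Literature.NumberTheory.Transcendental Literature.NumberTheory.Transcendental.KZ

namespace Summit.KontsevichZagierPeriods.KontsevichZagierPeriods.Theorems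

/-- `(w − 1)² + 1 ≠ 0` for `|w| < √2` (the zeros are `1 ± i`, of modulus `√2`). -/
theorem soloInformed_thetaDen_ne_zero {w : ℂ} (hw : ‖w‖ < Real.sqrt 2) : (w - 1) ^ 2 + 1 ≠ 0 := by
  have h1 : ‖(1 : ℂ) + Complex.I‖ = Real.sqrt 2 := by
    have := Complex.norm_add_mul_I 1 1
    simp only [Complex.ofReal_one, one_mul, one_pow] at this
    rw [this]; norm_num
  have h2 : ‖(1 : ℂ) - Complex.I‖ = Real.sqrt 2 := by
    have := Complex.norm_add_mul_I 1 (-1)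
    simp only [Complex.ofReal_one, Complex.ofReal_neg, neg_mul, one_mul, ← sub_eq_add_neg,
      one_pow, neg_one_sq] at this
    rw [this]; norm_num
  have hne₁ : w - (1 + Complex.I) ≠ 0 := by
    refine sub_ne_zero.2 ?_
    rintro rfl
    exact lt_irrefl _ (h1 ▸ hw)
  have hne₂ : w - (1 - Complex.I) ≠ 0 := by
    refine sub_ne_zero.2 ?_
    rintro rfl
    exact lt_irrefl _ (h2 ▸ hw)
  have : (w - 1) ^ 2 + 1 = (w - (1 + Complex.I)) * (w - (1 - Complex.I)) := by
    rw [show (w - (1 + Complex.I)) * (w - (1 - Complex.I)) = (w - 1) ^ 2 - Complex.I ^ 2 by ring,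
      Complex.I_sq]
    ring
  rw [this]
  exact mul_ne_zero hne₁ hne₂

/-- The generator `2·[π̂] = 8 / ((t − 1)² + 1)` on the disc of radius `√2`. -/
def soloInformedThetaIm : SoloInformedAyoubGen 1 where
  f z := 8 / ((z 0 - 1) ^ 2 + 1)
  ρ := Real.sqrt 2
  one_lt := by
    have := Real.sqrt_lt_sqrt zero_le_one (one_lt_two : (1 : ℝ) < 2)
    simpa using this
  analytic := by
    intro z hz
    have hz0 : ‖z 0‖ < Real.sqrt 2 := (norm_le_pi_norm z 0).trans_lt (mem_ball_zero_iff.1 hz)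
    have hc : AnalyticAt ℂ (fun w : Fin 1 → ℂ => w 0) z :=
      (ContinuousLinearMap.proj (R := ℂ) (φ := fun _ : Fin 1 => ℂ) 0).analyticAt z
    exact analyticAt_const.div (((hc.sub analyticAt_const).pow 2).add analyticAt_const)
      (soloInformed_thetaDen_ne_zero hz0)
  real x _ := by
    show ((8 : ℂ) / ((soloInformedToC 1 x 0 - 1) ^ 2 + 1)).im = 0
    have : (8 : ℂ) / ((soloInformedToC 1 x 0 - 1) ^ 2 + 1) = ((8 / ((x 0 - 1) ^ 2 + 1) : ℝ) : ℂ) := by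
      push_cast; simp
    rw [this, Complex.ofReal_im]
  algebraic := by
    refine ⟨MvPolynomial.X (Fin.last 1) * ((MvPolynomial.X (Fin.castSucc 0) - 1) ^ 2 + 1) - 8,
      fun h => ?_, fun z hz => ?_⟩
    · have := congrArg (MvPolynomial.eval fun _ => (1 : ℚ)) h
      norm_num at this
    · have hz0 : ‖z 0‖ < Real.sqrt 2 := (norm_le_pi_norm z 0).trans_lt (mem_ball_zero_iff.1 hz)
      simp only [map_sub, map_mul, map_add, map_pow, map_one, MvPolynomial.aeval_X, Fin.snoc_last,
        Fin.snoc_castSucc]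
      rw [div_mul_cancel₀ _ (soloInformed_thetaDen_ne_zero hz0)]
      norm_num

/-- Unfolding `soloInformedThetaIm`. -/
@[simp] theorem soloInformedThetaIm_f (z : Fin 1 → ℂ) :
    soloInformedThetaIm.f z = 8 / ((z 0 - 1) ^ 2 + 1) := rfl

/-- The zero generator in one variable. -/
def soloInformedThetaRe : SoloInformedAyoubGen 1 where
  f _ := 0
  ρ := 2
  one_lt := one_lt_two
  analytic := analyticOnNhd_const
  real _ _ := by simp
  algebraic := by
    refine ⟨MvPolynomial.X (Fin.last 1), fun h => ?_, fun z _ => ?_⟩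
    · have := congrArg (MvPolynomial.eval fun _ => (1 : ℚ)) h
      simp at this
    · rw [MvPolynomial.aeval_X, Fin.snoc_last]

/-- Unfolding `soloInformedThetaRe`. -/
@[simp] theorem soloInformedThetaRe_f (z : Fin 1 → ℂ) : soloInformedThetaRe.f z = 0 := rfl

/-- `∫₀¹ 8 dt / ((t − 1)² + 1) = 2π`. -/
theorem soloInformed_integral_theta :
    ∫ t in (0 : ℝ)..1, (8 : ℝ) / ((t - 1) ^ 2 + 1) = 2 * Real.pi := by
  have hderiv : ∀ t ∈ uIcc (0 : ℝ) 1,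
      HasDerivAt (fun t : ℝ => 8 * Real.arctan (t - 1)) (8 / ((t - 1) ^ 2 + 1)) t := by
    intro t _
    have h₁ : HasDerivAt (fun t : ℝ => t - 1) 1 t := (hasDerivAt_id t).sub_const 1
    have h₂ : HasDerivAt (Real.arctan ∘ fun t : ℝ => t - 1) (1 / (1 + (t - 1) ^ 2) * 1) t :=
      (Real.hasDerivAt_arctan (t - 1)).comp t h₁
    have h₃ : HasDerivAt (fun t : ℝ => 8 * Real.arctan (t - 1))
        (8 * (1 / (1 + (t - 1) ^ 2) * 1)) t := h₂.const_mul 8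
    exact h₃.congr_deriv (by ring)
  have hint : IntervalIntegrable (fun t : ℝ => (8 : ℝ) / ((t - 1) ^ 2 + 1)) volume 0 1 := by
    refine (Continuous.div continuous_const (by continuity) fun t => ?_).intervalIntegrable _ _
    positivity
  rw [intervalIntegral.integral_eq_sub_of_hasDerivAt hderiv hint]
  simp only [sub_self, Real.arctan_zero, mul_zero, zero_sub, Real.arctan_neg, Real.arctan_one,
    mul_neg, sub_neg_eq_add, zero_add]
  ring

/-- `Ev [2·π̂] = 2π`. -/
theorem soloInformedAyoubEv_thetaIm :
    soloInformedAyoubEv (soloInformedAyoubOf soloInformedThetaIm) = ((2 * Real.pi : ℝ) : ℂ) := by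
  rw [soloInformedAyoubEv_of]
  have hmp : MeasurePreserving (MeasurableEquiv.funUnique (Fin 1) ℝ) volume volume :=
    volume_preserving_funUnique (Fin 1) ℝ
  have hcube : soloInformedCube 1 = (MeasurableEquiv.funUnique (Fin 1) ℝ) ⁻¹' Icc (0 : ℝ) 1 := by
    ext u
    simp [MeasurableEquiv.funUnique, soloInformed_mem_cube_iff, Fin.forall_fin_one,
      Fin.default_eq_zero]
  have hfun : ∀ x : Fin 1 → ℝ, soloInformedThetaIm.f (soloInformedToC 1 x) =
      ((8 / ((x 0 - 1) ^ 2 + 1) : ℝ) : ℂ) := by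
    intro x
    rw [soloInformedThetaIm_f, soloInformedToC_apply]
    push_cast
    rfl
  simp_rw [hfun]
  rw [hcube]
  have h1 := hmp.setIntegral_preimage_emb (MeasurableEquiv.funUnique (Fin 1) ℝ).measurableEmbedding
    (fun t : ℝ => (((8 / ((t - 1) ^ 2 + 1) : ℝ)) : ℂ)) (Icc (0 : ℝ) 1)
  rw [show (fun x : Fin 1 → ℝ => (((8 / ((x 0 - 1) ^ 2 + 1) : ℝ)) : ℂ)) =
      fun x => (((8 / (((MeasurableEquiv.funUnique (Fin 1) ℝ) x - 1) ^ 2 + 1) : ℝ)) : ℂ) from rfl, h1,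
    integral_Icc_eq_integral_Ioc, ← intervalIntegral.integral_of_le zero_le_one,
    intervalIntegral.integral_ofReal, soloInformed_integral_theta]

/-- **The `θ`-clause of `SoloInformedAyoubEvInjLoc` (`Theorems/SoloInformedAyoubComplex.lean`)
is satisfiable**: `θ = 0 + i·(2π̂)` has `Ev θ = 2πi`. [Ayoub 2014, Def. 10] -/
theorem soloInformed_ayoubTheta_exists :
    ∃ g h : SoloInformedAyoubGen 1,
      soloInformedAyoubEv (soloInformedAyoubOf g) +
        soloInformedAyoubEv (soloInformedAyoubOf h) * Complex.I = 2 * Real.pi * Complex.I := by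
  refine ⟨soloInformedThetaRe, soloInformedThetaIm, ?_⟩
  rw [soloInformedAyoubEv_thetaIm, soloInformedAyoubEv_of]
  simp

end Summit.KontsevichZagierPeriods.KontsevichZagierPeriods.Theorems
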